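import Summits.BirchSwinnertonDyer.BirchSwinnertonDyer.Theorems.PrintCf2RubinValueTwoTwoVariableMCSemilocalColeman
import Literature.NumberTheory.GaloisRepresentations.LubinTateColemanCoordCoinvariantCharTwo
import Literature.NumberTheory.GaloisRepresentations.LubinTateColemanCoordCoinvariantDivisionTwo
import HarnessLib

/-!
# Brick (c) at `p = 2`, local `χ`-part, SERIES SIDE: `char_Λ ((N / Λ·{Col e(𝔠)})_ε) = char_Λ (Λ/(L_ε))` (`= (L_ε)` when `Λ` is factorial) —
# de Shalit III §1.4 (5) + Cor. 1.5 (7) + Lemma 1.10 (17) at `q = 2`, one prime, from the series-side II §4.12 (`φ_ε(span x) = L_ε·J_ε`, `Λ/J_ε` pseudo-null)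

Cell `bsd-print-cf2`, width seat `bsd-line-cf2c-w7` g13, route C `PrintCf2RubinValueTwo`, crux of record stmt-BirchSwinnertonDyer-24033
`TwoVariableMainConjAtSplitTwoQuad` (23720 nominal), BRICK §4(c); `--supports` the crux as a helper.  THEOREMS ONLY (0 sorry, no named fact, no
`def … : Prop`); Theses-free.  BSD is not proved by any of this.

Composition of three tree results: (1) `charIdeal_colemanCoinvariants_eq` (`Literature/…/LubinTateColemanCoordCoinvariantCharTwo`, g12): for
`Λ`-submodules `C ≤ N ≤ M` of the Coleman coordinate module with `σ_{−1}N ≤ N` and `M/N` pseudo-null, `char_Λ ((N/C)_ε) = char_Λ (Λ ⧸ φ_ε(C))`;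
(2) `existsUnique_colemanDeltaCoinvFun_eq_mul` / `colemanDeltaCoinvFun_map_span_range_eq_span_mul_of_forall` (`…/LubinTateColemanCoordCoinvariantDivisionTwo`,
g13): for a family `x : I → M` with de Shalit's cocycle relation, `φ_ε(x c) = (t_c − N_c)·L` for all `c`, so `φ_ε(Λ·span x) = L · J_ε`,
`J_ε = (t_c − N_c : c)`; (3) `SemilocalColeman.charIdeal_map_mkQ_eq` (`Theorems/…TwoVariableMCSemilocalColeman`, g0): the dévissage
`char(Λ₁/L·Λ₀) = char(Λ/(L))` for `Λ/Λ₀`, `Λ/Λ₁` pseudo-null.  What this file adds (generic commutative algebra + the instantiation):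

* §1 `isPseudoNull_quotient_top`, ★ `charIdeal_quotient_span_singleton_mul_eq` (**`char(R ⧸ (L)·J) = char(R ⧸ (L))`** for `R/J` pseudo-null, `L ≠ 0`,
  `R` a Noetherian domain), `charIdeal_quotient_span_singleton_mul_eq_span` (`= (L)`, factorial `R`), ★ `isPseudoNull_quotient_of_prime_mem`
  (**`R/J` is pseudo-null as soon as `J` contains a prime element `p₀` and an element `g ∉ (p₀)`** — the height-two criterion: a prime `𝔮 ⊇ J` contains
  `(p₀)` strictly, so `ht 𝔮 ≥ 2`), `span_range_mul_eq_span_singleton_mul` (`span{t_c·L} = (L)·span{t_c}`);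
* §2 (`Λ = S⟦T⟧`, `S` a `(π)`-complete Noetherian domain) `prime_X_sub_C` (**`T − b` is a prime element**, `b ∈ (π)`: `Λ/(T − b) ≅ S` by `tEval`),
  ★ `isPseudoNull_quotient_of_X_sub_C_mem` (**`Λ/J` is pseudo-null if `T − b ∈ J` and some `g ∈ J` has `g(b) ≠ 0`**);
* §3 ★★★ **`charIdeal_colemanCoinvariants_span_eq`** — for the Coleman coordinate module over any such base `S`: if `x : I → N ≤ M` satisfies the
  cocycle relation with `v a₁ = γ`, `N a₁ = C n₁` (`n₁ ≡ 1 mod π`), `(t_{v a₂} − N a₂)(n₁ − 1) ≠ 0`, `σ_{−1}N ≤ N`, `M/N` pseudo-null, and `L ≠ 0` is the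
  divided element (`φ_ε(x c) = (t_c − N c)·L ∀ c`), then **`char_Λ ((N / Λ·span{x c})_ε) = char_Λ (Λ ⧸ (L))`** (`= (L)` for factorial `Λ`:
  `…_eq_span`).  For `x c = Col e(𝔠)`, `N = Col(𝒰¹_∞)`: de Shalit's `char (𝒰/𝒞)_χ = (μ(𝔤; χ))` (III Lemma 1.10 (17)) at `q = 2`, one prime, modulo
  «closure of the elliptic units = their `Λ`-span» (g12 `colemanImageSubmodule`) and the identification of `L`'s weight values (g13 (31) + MI chain).

## References
* [deShalit1987] E. de Shalit, *Iwasawa theory of elliptic curves with complex multiplication* (1987), II §4.12 (29)–(33); III §1.4 (5), Cor. 1.5 (7),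
  §1.8 (14)–(15), Lemma 1.10 (17).
* [Washington1997] L. C. Washington, *Introduction to Cyclotomic Fields* (1997), §13.2.
* [BourbakiAC5to7] N. Bourbaki, *Algèbre commutative* VII §4 no. 4–5 (pseudo-null modules, characteristic ideals).
-/

noncomputable section

set_option linter.dupNamespace false
set_option autoImplicit false

namespace Summit.BirchSwinnertonDyer.BirchSwinnertonDyer.Theorems.PrintCf2.ColemanCoinvariantSeries

open Literature.NumberTheory.EllipticCurves
open Summit.BirchSwinnertonDyer.BirchSwinnertonDyer.Theorems.PrintCf2.SemilocalColeman

/-! ## §1. Generic commutative algebra: `char(R/(L)·J) = char(R/(L))` for `R/J` pseudo-null; the height-two criterion -/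

section Generic

variable {R : Type*} [CommRing R]

/-- `R ⧸ ⊤` is pseudo-null (it is zero). [cite: BourbakiAC5to7, Ch. VII §4 no. 4 Def. 2] -/
theorem isPseudoNull_quotient_top : Module.IsPseudoNull R (R ⧸ (⊤ : Ideal R)) := by
  haveI : Subsingleton (R ⧸ (⊤ : Ideal R)) := Ideal.Quotient.subsingleton_iff.mpr rfl
  exact Module.isPseudoNull_of_subsingleton R _

/-- ★ **`char(R ⧸ (L)·J) = char(R ⧸ (L))`** for a non-zero `L` and an ideal `J` with `R/J` pseudo-null (`R` a Noetherian domain): the dévissage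
`0 → (L)/(L)J ≅ R/J → R/(L)J → R/(L) → 0` (tree `SemilocalColeman.charIdeal_map_mkQ_eq` with `Λ₁ = R`). [cite: deShalit1987, III Cor. 1.5 (7), Lemma 1.10 (17)]
[cite: Washington1997, §13.2] -/
theorem charIdeal_quotient_span_singleton_mul_eq [IsNoetherianRing R] [IsDomain R] {L : R} (hL : L ≠ 0) {J : Ideal R}
    (hJ : Module.IsPseudoNull R (R ⧸ J)) :
    Module.charIdeal R (R ⧸ Ideal.span {L} * J) = Module.charIdeal R (R ⧸ Ideal.span {L}) := by
  have h := charIdeal_map_mkQ_eq hL hJ (isPseudoNull_quotient_top (R := R)) (le_top : Ideal.span {L} * J ≤ ⊤)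
  have e : ↥(Submodule.map (Submodule.mkQ (Ideal.span {L} * J)) (⊤ : Submodule R R)) ≃ₗ[R] (R ⧸ Ideal.span {L} * J) :=
    (LinearEquiv.ofEq _ _ (by rw [Submodule.map_top, Submodule.range_mkQ])).trans Submodule.topEquiv
  rw [← charIdeal_eq_of_linearEquiv e]
  exact h

/-- **`char(R ⧸ (L)·J) = (L)`** when moreover `R` is factorial. [cite: deShalit1987, III Cor. 1.5 (7)] [cite: Washington1997, §13.2] -/
theorem charIdeal_quotient_span_singleton_mul_eq_span [IsNoetherianRing R] [IsDomain R] [UniqueFactorizationMonoid R] {L : R} (hL : L ≠ 0)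
    {J : Ideal R} (hJ : Module.IsPseudoNull R (R ⧸ J)) :
    Module.charIdeal R (R ⧸ Ideal.span {L} * J) = Ideal.span {L} := by
  rw [charIdeal_quotient_span_singleton_mul_eq hL hJ, Module.charIdeal_quotient_span_singleton hL]

/-- ★ **THE HEIGHT-TWO CRITERION**: if an ideal `J` of a Noetherian domain contains a PRIME element `p₀` and an element `g` with `p₀ ∤ g`, then `R/J` is
pseudo-null — a prime `𝔮 ⊇ J` of height `≤ 1` would contain the height-one prime `(p₀)`, hence equal it, contradicting `g ∈ 𝔮`, `p₀ ∤ g`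
(de Shalit: "two relatively prime elements … any noetherian module annihilated by two relatively prime elements is pseudo-null").
[cite: deShalit1987, III Lemma 1.10 (proof, p. 96)] [cite: BourbakiAC5to7, Ch. VII §4 no. 4] -/
theorem isPseudoNull_quotient_of_prime_mem [IsNoetherianRing R] [IsDomain R] {J : Ideal R} {p₀ g : R} (hp₀ : Prime p₀)
    (hpJ : p₀ ∈ J) (hgJ : g ∈ J) (hg : ¬ p₀ ∣ g) : Module.IsPseudoNull R (R ⧸ J) := by
  intro 𝔮 h𝔮
  rw [LocalizedModule.subsingleton_iff]
  -- some element of `J` lies outside `𝔮`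
  suffices hex : ∃ r ∈ J, r ∉ 𝔮.asIdeal by
    obtain ⟨r, hrJ, hr𝔮⟩ := hex
    intro y
    obtain ⟨z, rfl⟩ := Ideal.Quotient.mk_surjective y
    refine ⟨r, hr𝔮, ?_⟩
    rw [Algebra.smul_def, Ideal.Quotient.algebraMap_eq, ← map_mul, Ideal.Quotient.eq_zero_iff_mem]
    exact J.mul_mem_right z hrJ
  by_contra hcon
  have hJ𝔮 : J ≤ 𝔮.asIdeal := fun r hr => by
    by_contra h
    exact hcon ⟨r, hr, h⟩
  haveI : (Ideal.span {p₀}).IsPrime := (Ideal.span_singleton_prime hp₀.ne_zero).mpr hp₀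
  have hle : Ideal.span {p₀} ≤ 𝔮.asIdeal := (Ideal.span_singleton_le_iff_mem _).mpr (hJ𝔮 hpJ)
  rcases hle.lt_or_eq with hlt | heq
  · have h1 := Ideal.height_add_one_le_of_lt_of_isPrime hlt
    rw [Module.height_span_singleton_eq_one_of_prime hp₀] at h1
    have h2 : (1 : ℕ∞) + 1 ≤ 1 := h1.trans h𝔮
    exact absurd h2 (by decide)
  · have hg𝔮 : g ∈ Ideal.span {p₀} := by rw [heq]; exact hJ𝔮 hgJ
    exact hg (Ideal.mem_span_singleton.mp hg𝔮)

/-- `span {t c · L : c} = (L) · span {t c : c}`. [cite: deShalit1987, III §1.4 (5)] -/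
theorem span_range_mul_eq_span_singleton_mul {I : Type*} (t : I → R) (L : R) :
    Ideal.span (Set.range fun c => t c * L) = Ideal.span {L} * Ideal.span (Set.range t) := by
  refine le_antisymm (Ideal.span_le.mpr ?_) (Ideal.mul_le.mpr ?_)
  · rintro _ ⟨c, rfl⟩
    change t c * L ∈ Ideal.span {L} * Ideal.span (Set.range t)
    exact mul_comm L (t c) ▸ Ideal.mul_mem_mul (Ideal.mem_span_singleton_self L) (Ideal.subset_span (Set.mem_range_self c))
  · intro r hr s hs
    obtain ⟨a, rfl⟩ := Ideal.mem_span_singleton'.mp hr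
    rw [mul_assoc, mul_comm L s]
    refine Ideal.mul_mem_left _ a ?_
    refine Submodule.span_induction (p := fun s _ => s * L ∈ Ideal.span (Set.range fun c => t c * L)) ?_ ?_ ?_ ?_ hs
    · rintro _ ⟨c, rfl⟩; exact Ideal.subset_span (Set.mem_range_self c)
    · rw [zero_mul]; exact zero_mem _
    · intro x y _ _ hx hy; rw [add_mul]; exact add_mem hx hy
    · intro a x _ hx; rw [smul_eq_mul, mul_assoc]; exact Ideal.mul_mem_left _ a hx

end Generic

/-! ## §2. `Λ = S⟦T⟧`: `T − b` is a prime element; `Λ/J` is pseudo-null when `T − b ∈ J ∋ g`, `g(b) ≠ 0` -/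

section Lambda

open Literature.NumberTheory.GaloisRepresentations.LubinTate

variable {S : Type*} [CommRing S] {p : S} [IsAdicComplete (Ideal.span {p}) S] {b : S} (hb : b ∈ Ideal.span {p})

include hb in
/-- `(T − b) = ker tEval_b` as ideals of `S⟦T⟧`. [cite: Washington1997, §7.1 Prop. 7.2] -/
theorem span_X_sub_C_eq_ker_tEvalHom : Ideal.span {(PowerSeries.X - PowerSeries.C b : PowerSeries S)} = RingHom.ker (tEvalHom hb) := by
  ext f
  rw [RingHom.mem_ker, tEvalHom_apply, mem_span_X_sub_C_iff_tEval_eq_zero hb]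

include hb in
/-- ★ **`T − b` is a PRIME element of `S⟦T⟧`** for `S` a `(π)`-adically complete domain and `b ∈ (π)`: `S⟦T⟧/(T − b) ≅ S` by evaluation at `b`.
[cite: Washington1997, §7.1 Prop. 7.2] -/
theorem prime_X_sub_C [IsDomain S] : Prime (PowerSeries.X - PowerSeries.C b : PowerSeries S) := by
  have hne : (PowerSeries.X - PowerSeries.C b : PowerSeries S) ≠ 0 := nonZeroDivisors.ne_zero (X_sub_C_mem_nonZeroDivisors hb)
  rw [← Ideal.span_singleton_prime hne, span_X_sub_C_eq_ker_tEvalHom hb]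
  exact RingHom.ker_isPrime _

/-- ★ **`Λ/J` is pseudo-null when `T − b ∈ J` and `g ∈ J` with `g(b) ≠ 0`** (`Λ = S⟦T⟧`, `S` a `(π)`-complete Noetherian domain): the two elements are
"relatively prime" (height two). [cite: deShalit1987, III Lemma 1.10 (proof, p. 96)] -/
theorem isPseudoNull_quotient_of_X_sub_C_mem [IsDomain S] [IsNoetherianRing S] {J : Ideal (PowerSeries S)}
    (hXJ : (PowerSeries.X - PowerSeries.C b : PowerSeries S) ∈ J) {g : PowerSeries S} (hgJ : g ∈ J) (hg : tEval hb g ≠ 0) :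
    Module.IsPseudoNull (PowerSeries S) (PowerSeries S ⧸ J) := by
  refine isPseudoNull_quotient_of_prime_mem (prime_X_sub_C hb) hXJ hgJ fun hdvd => hg ?_
  obtain ⟨q, rfl⟩ := hdvd
  rw [mul_comm, tEval_mul_X_sub_C]

end Lambda

/-! ## §3. The Coleman coordinate module: `char ((N / span x)_ε) = char (Λ/(L))` -/

section Coleman

open Literature.NumberTheory.GaloisRepresentations Literature.NumberTheory.GaloisRepresentations.IsNonarchimedeanLocalField
  Literature.NumberTheory.GaloisRepresentations.LubinTate ValuativeRel

variable {F : Type} [Field F] [ValuativeRel F] [TopologicalSpace F] [IsNonarchimedeanLocalField F]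

attribute [local instance] ltNormUniformSpace ltNormIsUniformAddGroup rk1 nF nE fintypeResidueField

variable {π : 𝒪[F]} (hπ : (valuation F).IsUniformizer (π : F)) (hq : residueFieldCard F = 2)
variable {S : Type*} [CommRing S] [IsDomain S] [IsNoetherianRing S] (ι : LTCoeff F →+* S) [IsAdicComplete (Ideal.span {ι (LTCoeff.of F π)}) S]
variable (u : (LTCoeff F)ˣ) (hu : LTCoeff.of F π = residueFieldCard F * u) (γ : 𝒪[F]ˣ)
variable (hreg : ∀ s : S, ι (LTCoeff.of F π) * s = 0 → s = 0) (w : 𝒪[F]ˣ) (hγ : (γ : 𝒪[F]) = 1 + π ^ 2 * w)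
variable (ε : PowerSeries S) (hε : ε * ε = 1)

include hε in
/-- ★★★ **THE LOCAL (c)-IDENTITY ON THE SERIES SIDE, `ε`-part, one prime, `q = 2`** (de Shalit III §1.4 (5) + Cor. 1.5 (7) + Lemma 1.10 (17)): let
`x : I → M` (`M` the Coleman coordinate module over a `(π)`-complete Noetherian domain `S`) satisfy the cocycle relation of II §2.4 (ii) with an
index `a₁` of `v a₁ = γ`, `N a₁ = C n₁` (`n₁ ≡ 1 mod π`) and an index `a₂` with `(t_{v a₂} − N a₂)(n₁ − 1) ≠ 0`; let `L ≠ 0` satisfy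
`φ_ε(x c) = (t_{v c} − N c)·L` for all `c` (it exists uniquely: `existsUnique_colemanDeltaCoinvFun_eq_mul`); let `N₀` be a `Λ`-submodule with
`span{x c} ≤ N₀`, `σ_{−1}N₀ ≤ N₀` and `M/N₀` pseudo-null (e.g. `N₀ = Col(𝒰¹_∞)`).  Then
**`char_Λ ((N₀ / Λ·span{x c})_ε) = char_Λ (Λ ⧸ (L))`.** [cite: deShalit1987, III §1.4 (5), Cor. 1.5 (7), Lemma 1.10 (17); II §4.12 (33)] -/
theorem charIdeal_colemanCoinvariants_span_eq {I : Type*} (x : I → ColemanCoordModule hπ hq ι u hu γ) (v : I → 𝒪[F]ˣ) (Nm : I → PowerSeries S)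
    (a₁ a₂ : I) (hv₁ : v a₁ = γ) {n₁ : S} (hN₁ : Nm a₁ = PowerSeries.C n₁) (hn₁ : n₁ - 1 ∈ Ideal.span {ι (LTCoeff.of F π)})
    (ha₂ : tEval hn₁ (colemanDeltaCoinvFun hπ hq ι u hu γ hreg w hγ ε
        (unitTwistₗ hπ hq ι u hu γ (v a₂) (TActModule.ofPS _ _ 1)) - Nm a₂) ≠ 0)
    (L : PowerSeries S) (hL0 : L ≠ 0)
    (hL : ∀ c : I, colemanDeltaCoinvFun hπ hq ι u hu γ hreg w hγ ε (x c) =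
      (colemanDeltaCoinvFun hπ hq ι u hu γ hreg w hγ ε (unitTwistₗ hπ hq ι u hu γ (v c) (TActModule.ofPS _ _ 1)) - Nm c) * L)
    (N₀ : Submodule (PowerSeries S) (ColemanCoordModule hπ hq ι u hu γ)) (hN₀ : ∀ n ∈ N₀, unitTwistₗ hπ hq ι u hu γ (-1) n ∈ N₀)
    (hxN₀ : Submodule.span (PowerSeries S) (Set.range x) ≤ N₀)
    (hMN₀ : Module.IsPseudoNull (PowerSeries S) (ColemanCoordModule hπ hq ι u hu γ ⧸ N₀)) :
    Module.charIdeal (PowerSeries S) (N₀ ⧸ colemanCoinvRel hπ hq ι u hu γ ε N₀ hN₀ (Submodule.span (PowerSeries S) (Set.range x))) =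
      Module.charIdeal (PowerSeries S) (PowerSeries S ⧸ Ideal.span {L}) := by
  -- (1) coinvariants ↦ the cyclic module `Λ/φ_ε(span x)`
  rw [charIdeal_colemanCoinvariants_eq hπ hq ι u hu γ hreg w hγ ε hε N₀ hN₀ _ hxN₀ hMN₀]
  -- (2) `φ_ε(span x) = (L) · J_ε`
  have hmap := colemanDeltaCoinvFun_map_span_range_eq_span_mul_of_forall hπ hq ι u hu γ hreg w hγ ε x v Nm L hL
  rw [span_range_mul_eq_span_singleton_mul] at hmap
  have e : (PowerSeries S ⧸ (Submodule.span (PowerSeries S) (Set.range x)).map (colemanDeltaCoinvFun hπ hq ι u hu γ hreg w hγ ε)) ≃ₗ[PowerSeries S]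
      (PowerSeries S ⧸ Ideal.span {L} * Ideal.span (Set.range fun c =>
        colemanDeltaCoinvFun hπ hq ι u hu γ hreg w hγ ε (unitTwistₗ hπ hq ι u hu γ (v c) (TActModule.ofPS _ _ 1)) - Nm c)) :=
    Submodule.quotEquivOfEq _ _ hmap
  rw [charIdeal_eq_of_linearEquiv e]
  -- (3) `Λ/J_ε` is pseudo-null: `J_ε ∋ T − C(n₁ − 1)` (index `a₁`) and `∋ t₂ − N₂` with non-zero value at `n₁ − 1` (index `a₂`)
  refine charIdeal_quotient_span_singleton_mul_eq hL0 (isPseudoNull_quotient_of_X_sub_C_mem hn₁ ?_ (Ideal.subset_span ⟨a₂, rfl⟩) ha₂)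
  have e : colemanDeltaCoinvFun hπ hq ι u hu γ hreg w hγ ε (unitTwistₗ hπ hq ι u hu γ (v a₁) (TActModule.ofPS _ _ 1)) - Nm a₁ =
      PowerSeries.X - PowerSeries.C (n₁ - 1) := by
    rw [hv₁, hN₁, colemanDeltaCoinvFun_unitTwistₗ_self_one_sub_C, one_mul]
  rw [← e]
  exact Ideal.subset_span ⟨a₁, rfl⟩

include hε in
/-- ★★★ **Factorial base**: under the same hypotheses with `Λ = S⟦T⟧` factorial (e.g. `S = 𝒪_E` a DVR), **`char_Λ ((N₀ / Λ·span{x c})_ε) = (L)`** —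
de Shalit's `char (𝒰/𝒞)_χ = (μ(𝔤; χ))` (III Lemma 1.10 (17)) at `q = 2`, one prime, series side, modulo «`𝒞̄` = `Λ`-span of the `e(𝔞)`».
[cite: deShalit1987, III Cor. 1.5 (7), Lemma 1.10 (17)] [cite: Washington1997, §13.2] -/
theorem charIdeal_colemanCoinvariants_span_eq_span [UniqueFactorizationMonoid (PowerSeries S)] {I : Type*}
    (x : I → ColemanCoordModule hπ hq ι u hu γ) (v : I → 𝒪[F]ˣ) (Nm : I → PowerSeries S)
    (a₁ a₂ : I) (hv₁ : v a₁ = γ) {n₁ : S} (hN₁ : Nm a₁ = PowerSeries.C n₁) (hn₁ : n₁ - 1 ∈ Ideal.span {ι (LTCoeff.of F π)})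
    (ha₂ : tEval hn₁ (colemanDeltaCoinvFun hπ hq ι u hu γ hreg w hγ ε
        (unitTwistₗ hπ hq ι u hu γ (v a₂) (TActModule.ofPS _ _ 1)) - Nm a₂) ≠ 0)
    (L : PowerSeries S) (hL0 : L ≠ 0)
    (hL : ∀ c : I, colemanDeltaCoinvFun hπ hq ι u hu γ hreg w hγ ε (x c) =
      (colemanDeltaCoinvFun hπ hq ι u hu γ hreg w hγ ε (unitTwistₗ hπ hq ι u hu γ (v c) (TActModule.ofPS _ _ 1)) - Nm c) * L)
    (N₀ : Submodule (PowerSeries S) (ColemanCoordModule hπ hq ι u hu γ)) (hN₀ : ∀ n ∈ N₀, unitTwistₗ hπ hq ι u hu γ (-1) n ∈ N₀)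
    (hxN₀ : Submodule.span (PowerSeries S) (Set.range x) ≤ N₀)
    (hMN₀ : Module.IsPseudoNull (PowerSeries S) (ColemanCoordModule hπ hq ι u hu γ ⧸ N₀)) :
    Module.charIdeal (PowerSeries S) (N₀ ⧸ colemanCoinvRel hπ hq ι u hu γ ε N₀ hN₀ (Submodule.span (PowerSeries S) (Set.range x))) =
      Ideal.span {L} := by
  rw [charIdeal_colemanCoinvariants_span_eq hπ hq ι u hu γ hreg w hγ ε hε x v Nm a₁ a₂ hv₁ hN₁ hn₁ ha₂ L hL0 hL N₀ hN₀ hxN₀ hMN₀,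
    Module.charIdeal_quotient_span_singleton hL0]

end Coleman

end Summit.BirchSwinnertonDyer.BirchSwinnertonDyer.Theorems.PrintCf2.ColemanCoinvariantSeries
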